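import Mathlib
import Summits.NavierStokesRegularity.NavierStokesRegularity.Theorems.FilamentSkeletonRssStadiumPartnerPiece

/-!
# Route `FilamentSkeletonRss` · twin child cruxes `TangentSkeletonNearStraight` (stmt-28295) / `TangentSkeletonNearStraightL` (stmt-23320) ·
# shared registered stub `stub_stripPropagation : StripPropagation` — brick: SCHWARZ REFLECTION ON THE STADIUM (lower half-stadium from the upper)

The quarter-width corner certificates (hands leafhand-15: `Theorems.StadiumCornerLeft`, `Theorems.StadiumCornerRightNear`, …) are stated for
targets `x₀ + iY` with `0 ≤ Y` (blueprint item R3: «`Im z < 0` by reflection»).  The stub's continuations are REAL on the real trace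
(`F t = cplx (X t)`, `G t = A t`), the stadium `S = {|Im z| < hs, |Re z − cc| < L + hs}` is symmetric under complex conjugation, open and convex,
so by the identity theorem (SCHWARZ REFLECTION in its interior form)
  `F (conj z) = conj ∘ F z`,  `G (conj z) = conj (G z)`  on `S`
(`stadium_F_conj`, `stadium_G_conj`, from the general `apply_conj_eq_conj_of_isPreconnected`), and therefore the matched-kernel base at mirrored
target and source is the conjugate of the original one (`kernelBase_conj`): its REAL PART — the quantity every positivity certificate bounds — is the
same (`kernelBase_re_conj`).  Every certificate proved for `Y ≥ 0` holds verbatim at `−Y` with the mirrored contour.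
HONEST FRAMING: a complex-analysis brick for the bookkeeping of a HYPOTHETICAL filament skeleton on the NEGATIVE side of a MODEL route; no stub of
28295 / 23320 is closed here; nothing here bears on Navier–Stokes regularity or blow-up.  `--supports stmt-NavierStokesRegularity-28295`.
-/

set_option linter.dupNamespace false

noncomputable section

namespace Summit.NavierStokesRegularity.NavierStokesRegularity.Theorems.StadiumSchwarzReflection

open Set Filter Topology Complex
open Summit.NavierStokesRegularity.NavierStokesRegularity.Theorems.StadiumPartnerPiece
open scoped InnerProductSpace ComplexConjugate

/-! ## §1  Interior Schwarz reflection on a conjugation-symmetric preconnected open set -/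

/-- **Interior Schwarz reflection (scalar).**  `U` open, preconnected, symmetric under `conj`, containing a real segment `[a, b]` (`a < b`) on which
the holomorphic `f` is real-valued: then `f (conj z) = conj (f z)` on `U`. [folklore; identity theorem] -/
theorem apply_conj_eq_conj_of_isPreconnected {U : Set ℂ} (hU : IsOpen U) (hUc : IsPreconnected U)
    (hsymm : ∀ z ∈ U, conj z ∈ U) {f : ℂ → ℂ} (hf : DifferentiableOn ℂ f U) {a b : ℝ} (hab : a < b)
    (hsub : ∀ t : ℝ, t ∈ Icc a b → (t : ℂ) ∈ U) (hreal : ∀ t : ℝ, t ∈ Icc a b → (f t).im = 0) :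
    ∀ z ∈ U, f (conj z) = conj (f z) := by
  -- the reflected function and the defect
  set g : ℂ → ℂ := fun z => conj (f (conj z)) with hgdef
  have hg : DifferentiableOn ℂ g U := by
    intro z hz
    have hfz : DifferentiableAt ℂ f (conj z) := hf.differentiableAt (hU.mem_nhds (hsymm z hz))
    have h := hfz.conj_conj
    rw [Complex.conj_conj] at h
    exact h.differentiableWithinAt
  have hDd : DifferentiableOn ℂ (fun z => f z - g z) U := hf.sub hg
  have hDa : AnalyticOnNhd ℂ (fun z => f z - g z) U := hDd.analyticOnNhd hU
  -- the defect vanishes at the real points of `[a, b]`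
  have hzero : ∀ t ∈ Ioo a b, f (t : ℂ) - g (t : ℂ) = 0 := by
    intro t ht
    have him := hreal t (Ioo_subset_Icc_self ht)
    have hc : conj (f (t : ℂ)) = f (t : ℂ) := Complex.conj_eq_iff_im.mpr him
    simp only [hgdef, Complex.conj_ofReal, hc, sub_self]
  -- identity theorem from the segment
  set t₀ : ℝ := (a + b) / 2 with ht₀def
  have ht₀ : t₀ ∈ Ioo a b := by constructor <;> (rw [ht₀def]; linarith)
  have htend : Tendsto (fun t : ℝ => (t : ℂ)) (𝓝[≠] t₀) (𝓝[≠] ((t₀ : ℝ) : ℂ)) := by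
    refine tendsto_nhdsWithin_of_tendsto_nhds_of_eventually_within _
      (Complex.continuous_ofReal.continuousAt.mono_left nhdsWithin_le_nhds) ?_
    filter_upwards [self_mem_nhdsWithin] with t ht
    simpa using ht
  have hev : ∀ᶠ t : ℝ in 𝓝[≠] t₀, f (t : ℂ) - g (t : ℂ) = 0 := by
    have : ∀ᶠ t : ℝ in 𝓝[≠] t₀, t ∈ Ioo a b := mem_nhdsWithin_of_mem_nhds (Ioo_mem_nhds ht₀.1 ht₀.2)
    exact this.mono fun t ht => hzero t ht
  have hfreq : ∃ᶠ z in 𝓝[≠] ((t₀ : ℝ) : ℂ), f z - g z = 0 := htend.frequently hev.frequently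
  have hEq := hDa.eqOn_zero_of_preconnected_of_frequently_eq_zero hUc (hsub t₀ (Ioo_subset_Icc_self ht₀)) hfreq
  intro z hz
  have h := hEq (hsymm z hz)
  simp only [Pi.zero_apply, sub_eq_zero, hgdef, Complex.conj_conj] at h
  exact h

/-- **Interior Schwarz reflection (vector, componentwise).**  Same, for `F : ℂ → ℂ³` real on the segment (e.g. `F t = cplx (X t)`). [folklore] -/
theorem apply_conj_eq_conj_pi {U : Set ℂ} (hU : IsOpen U) (hUc : IsPreconnected U)
    (hsymm : ∀ z ∈ U, conj z ∈ U) {F : ℂ → (Fin 3 → ℂ)} (hF : DifferentiableOn ℂ F U) {a b : ℝ} (hab : a < b)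
    (hsub : ∀ t : ℝ, t ∈ Icc a b → (t : ℂ) ∈ U) (hreal : ∀ t : ℝ, t ∈ Icc a b → ∀ i, (F t i).im = 0) :
    ∀ z ∈ U, ∀ i, F (conj z) i = conj (F z i) := by
  intro z hz i
  have hFi : DifferentiableOn ℂ (fun w => F w i) U := differentiableOn_pi.1 hF i
  exact apply_conj_eq_conj_of_isPreconnected hU hUc hsymm hFi hab hsub (fun t ht => hreal t ht i) z hz

/-! ## §2  The stadium -/

/-- The stadium is convex. [folklore] -/
theorem convex_stadium (hs R cc : ℝ) : Convex ℝ {z : ℂ | |z.im| < hs ∧ |z.re - cc| < R} := by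
  have h1 : Convex ℝ {z : ℂ | |z.im| < hs} := by
    have : {z : ℂ | |z.im| < hs} = Complex.imLm ⁻¹' Set.Ioo (-hs) hs := by
      ext z; simp [abs_lt]
    rw [this]; exact (convex_Ioo _ _).linear_preimage _
  have h2 : Convex ℝ {z : ℂ | |z.re - cc| < R} := by
    have : {z : ℂ | |z.re - cc| < R} = Complex.reLm ⁻¹' Set.Ioo (cc - R) (cc + R) := by
      ext z; simp only [Set.mem_setOf_eq, Set.mem_preimage, Set.mem_Ioo, Complex.reLm_coe, abs_lt]
      constructor <;> rintro ⟨h₁, h₂⟩ <;> constructor <;> linarith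
    rw [this]; exact (convex_Ioo _ _).linear_preimage _
  exact h1.inter h2

/-- The stadium is symmetric under complex conjugation. [folklore] -/
theorem conj_mem_stadium {hs R cc : ℝ} {z : ℂ} (hz : z ∈ {z : ℂ | |z.im| < hs ∧ |z.re - cc| < R}) :
    conj z ∈ {z : ℂ | |z.im| < hs ∧ |z.re - cc| < R} := by
  refine ⟨?_, ?_⟩
  · rw [Complex.conj_im, abs_neg]; exact hz.1
  · rw [Complex.conj_re]; exact hz.2

/-- A short real segment around the centre lies in the stadium (`0 < hs`, `0 ≤ L`). [folklore] -/
theorem real_segment_mem_stadium {hs L cc : ℝ} (hhs : 0 < hs) (hL : 0 ≤ L) {t : ℝ} (ht : t ∈ Icc (cc - hs / 2) (cc + hs / 2)) :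
    (t : ℂ) ∈ {z : ℂ | |z.im| < hs ∧ |z.re - cc| < L + hs} := by
  refine ⟨by simpa using hhs, ?_⟩
  show |(t : ℂ).re - cc| < L + hs
  rw [Complex.ofReal_re, abs_lt]
  constructor <;> linarith [ht.1, ht.2]

/-- **Schwarz reflection for the stub's curve continuation.**  `F` holomorphic on the stadium and equal to the complexified real curve on its real
trace: `F (conj z) = conj ∘ F z` componentwise on the stadium. [folklore] -/
theorem stadium_F_conj {hs L cc : ℝ} (hhs : 0 < hs) (hL : 0 ≤ L) {F : ℂ → (Fin 3 → ℂ)}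
    (hF : DifferentiableOn ℂ F {z : ℂ | |z.im| < hs ∧ |z.re - cc| < L + hs})
    {X : ℝ → EuclideanSpace ℝ (Fin 3)}
    (hFX : ∀ t : ℝ, (t : ℂ) ∈ {z : ℂ | |z.im| < hs ∧ |z.re - cc| < L + hs} →
      F t = fun i => ((⟪X t, EuclideanSpace.single i (1:ℝ)⟫_ℝ : ℝ) : ℂ)) :
    ∀ z ∈ {z : ℂ | |z.im| < hs ∧ |z.re - cc| < L + hs}, ∀ i, F (conj z) i = conj (F z i) := by
  have hab : cc - hs / 2 < cc + hs / 2 := by linarith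
  refine apply_conj_eq_conj_pi (isOpen_stadium hs (L + hs) cc) (convex_stadium hs (L + hs) cc).isPreconnected
    (fun z hz => conj_mem_stadium hz) hF hab (fun t ht => real_segment_mem_stadium hhs hL ht) ?_
  intro t ht i
  rw [hFX t (real_segment_mem_stadium hhs hL ht)]
  exact Complex.ofReal_im _

/-- **Schwarz reflection for the stub's core-area continuation.**  `G` holomorphic on the stadium and equal to the real core area on its real trace:
`G (conj z) = conj (G z)` on the stadium. [folklore] -/
theorem stadium_G_conj {hs L cc : ℝ} (hhs : 0 < hs) (hL : 0 ≤ L) {G : ℂ → ℂ}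
    (hG : DifferentiableOn ℂ G {z : ℂ | |z.im| < hs ∧ |z.re - cc| < L + hs})
    {A : ℝ → ℝ}
    (hGA : ∀ t : ℝ, (t : ℂ) ∈ {z : ℂ | |z.im| < hs ∧ |z.re - cc| < L + hs} → G t = ((A t : ℝ) : ℂ)) :
    ∀ z ∈ {z : ℂ | |z.im| < hs ∧ |z.re - cc| < L + hs}, G (conj z) = conj (G z) := by
  have hab : cc - hs / 2 < cc + hs / 2 := by linarith
  refine apply_conj_eq_conj_of_isPreconnected (isOpen_stadium hs (L + hs) cc) (convex_stadium hs (L + hs) cc).isPreconnected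
    (fun z hz => conj_mem_stadium hz) hG hab (fun t ht => real_segment_mem_stadium hhs hL ht) ?_
  intro t ht
  rw [hGA t (real_segment_mem_stadium hhs hL ht)]
  exact Complex.ofReal_im _

/-! ## §3  The matched-kernel base at mirrored target and source -/

/-- **Mirrored kernel base is the conjugate.**  With `F (conj ·) = conj ∘ F`, `G (conj ·) = conj ∘ G` at the points involved and a real core constant
`κ`: `Σᵢ (Fᵢ(conj ζ) − Fᵢ(conj z))² + κ·G(conj ζ) = conj (Σᵢ (Fᵢ ζ − Fᵢ z)² + κ·G ζ)`. [folklore] -/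
theorem kernelBase_conj {F : ℂ → (Fin 3 → ℂ)} {G : ℂ → ℂ} {z ζ : ℂ} {κ : ℝ}
    (hFz : ∀ i, F (conj z) i = conj (F z i)) (hFζ : ∀ i, F (conj ζ) i = conj (F ζ i)) (hGζ : G (conj ζ) = conj (G ζ)) :
    (∑ i, (F (conj ζ) i - F (conj z) i) ^ 2) + (κ : ℂ) * G (conj ζ) = conj ((∑ i, (F ζ i - F z i) ^ 2) + (κ : ℂ) * G ζ) := by
  simp only [map_add, map_sum, map_pow, map_sub, map_mul, Complex.conj_ofReal, hFz, hFζ, hGζ]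

/-- **Same real part at the mirrored configuration** — the form in which every positivity / lower-bound certificate transfers from `Y ≥ 0` to
`Y ≤ 0`. [folklore] -/
theorem kernelBase_re_conj {F : ℂ → (Fin 3 → ℂ)} {G : ℂ → ℂ} {z ζ : ℂ} {κ : ℝ}
    (hFz : ∀ i, F (conj z) i = conj (F z i)) (hFζ : ∀ i, F (conj ζ) i = conj (F ζ i)) (hGζ : G (conj ζ) = conj (G ζ)) :
    ((∑ i, (F (conj ζ) i - F (conj z) i) ^ 2) + (κ : ℂ) * G (conj ζ)).re = ((∑ i, (F ζ i - F z i) ^ 2) + (κ : ℂ) * G ζ).re := by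
  rw [kernelBase_conj hFz hFζ hGζ, Complex.conj_re]

/-- The bare chord quadric alone: `Σᵢ (Fᵢ(conj ζ) − Fᵢ(conj z))² = conj Σᵢ (Fᵢ ζ − Fᵢ z)²`, hence equal real parts and equal norms. [folklore] -/
theorem chordQuadric_conj {F : ℂ → (Fin 3 → ℂ)} {z ζ : ℂ}
    (hFz : ∀ i, F (conj z) i = conj (F z i)) (hFζ : ∀ i, F (conj ζ) i = conj (F ζ i)) :
    (∑ i, (F (conj ζ) i - F (conj z) i) ^ 2) = conj (∑ i, (F ζ i - F z i) ^ 2) ∧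
      (∑ i, (F (conj ζ) i - F (conj z) i) ^ 2).re = (∑ i, (F ζ i - F z i) ^ 2).re ∧
      ‖∑ i, (F (conj ζ) i - F (conj z) i) ^ 2‖ = ‖∑ i, (F ζ i - F z i) ^ 2‖ := by
  have h : (∑ i, (F (conj ζ) i - F (conj z) i) ^ 2) = conj (∑ i, (F ζ i - F z i) ^ 2) := by
    simp only [map_sum, map_pow, map_sub, hFz, hFζ]
  exact ⟨h, by rw [h, Complex.conj_re], by rw [h, Complex.norm_conj]⟩

/-- **Mirrored targets and sources, concretely.**  `conj (x₀ + iY) = x₀ + i(−Y)` and `conj ((x₀ + iY) + (D − i·E)) = (x₀ + i(−Y)) + (D − i(−E))`: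
the plateau source `z + D` and the descent source `z + (D − iE)` of a target `z = x₀ + iY` mirror to the same-named sources of the target `x₀ − iY`
with `E ↦ −E`. [folklore] -/
theorem conj_target_source (x₀ Y D E : ℝ) :
    conj ((x₀ : ℂ) + (Y : ℂ) * I) = (x₀ : ℂ) + ((-Y : ℝ) : ℂ) * I ∧
    conj (((x₀ : ℂ) + (Y : ℂ) * I) + ((D : ℂ) - (E : ℂ) * I)) =
      ((x₀ : ℂ) + ((-Y : ℝ) : ℂ) * I) + ((D : ℂ) - ((-E : ℝ) : ℂ) * I) := by
  constructor
  · apply Complex.ext <;> simp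
  · apply Complex.ext <;> simp

end Summit.NavierStokesRegularity.NavierStokesRegularity.Theorems.StadiumSchwarzReflection
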